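import Summits.BirchSwinnertonDyer.BirchSwinnertonDyer.Theorems.PrintCFramBottomClassIndexLawFiveLeKummerRadicalCharacterEquivariance
import Summits.BirchSwinnertonDyer.BirchSwinnertonDyer.Theorems.PrintCFramBottomClassIndexLawFiveLeKummerClassRadical
import Literature.NumberTheory.NumberFields.UnitsEvenEigenunitExists
import HarnessLib

/-!
# Route `PrintCFram`, crux C2 `BottomClassIndexLawFiveLe` (stmt-BirchSwinnertonDyer-20372), line
# `eisenstein-resource-bdp-line` (B1 first-order census, CASE R): **EVEN-IRREGULAR ⟹ TWO INDEPENDENT ADMISSIBLE CHARACTERS** —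
# the Minkowski unit and the class radical of an even eigenclass give Kummer characters `κ₁, κ₂ : Γ_K →* ℤ/p` with open
# kernels, killing the inertia above every `v ∤ p`, `ā ē⁻¹`-isotypic under `absGaloisOuterConj`, and `κ₁^i κ₂^j = 1 ⟹ p ∣ i, j`
# (cell `bsd-print-cfram`, width seat `bsd-line-cfram-p1-w7` g4; helper `--supports` 20372; 0 defs, 0 facts, 0 sorry)

HONEST FRAMING. Nothing about BSD is proved here, no stub is closed. This is the NUMBER-THEORETIC half of the Leopoldt lower bound
«EVEN-IRREGULAR(K) ⟹ #R_rel(ψ) ≥ p²» (w2 g10's successor item, HOME/STATUS 00:00:48Z): the two radicals —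
`Literature…UnitGalois.exists_even_eigenunit` (Herbrand's Minkowski unit, this seat) and `KummerRadical.exists_eigenRadical_of_eigenclass`
(the class radical, this seat) — are turned into characters of `Γ_K` by `KummerRadical.exists_kummer_character` and checked against the
three admissibility conditions of w2 g9's bridge `SelmerCount.exists_characters_natCard_h1Unramified_le` (open kernel —
`isOpen_ker_kummer_character`; inertia — `kummer_character_eq_one_of_mem_inertia` at a `v`-unit representative; conjugation law —
`kummer_character_absGaloisOuterConj`), and shown INDEPENDENT (a relation `κ₁^i κ₂^j = 1` makes `u^i α^j` a `p`-th power in `K`,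
contradicting `α ∉ E_K K^{×p}` or `u ∉ μ_K E_K^p`). What remains for «CO-ALIGNED ∧ EVEN-IRREGULAR ⟹ Ш(W)[p] ≠ 0» is Galois
cohomology only: the `S`-relaxed form of w4 g8's LINK `LevelDictionary.exists_unramified_class_of_hom_of_le_ker` and the count
`p² ≤ #h1Unramified (ψ-line) S_p` feeding w2 g10's `SelmerCount.exists_sha_ne_zero_of_coaligned_of_sq_le_of_cmRamified`.
* `kummer_character_mul_root` — the character of a product of roots; `kummer_character_eq_one_of_mem_inertia_of_repr` — inertia
  via a `v`-unit representative `α γ^p`;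
* **`exists_two_independent_kummer_characters`**.
THEOREMS ONLY; no definition, no named fact, no `sorry`. BSD is not proved by any of this; no summit statement is proved by this seat.
References: [Washington1997] §10.2 (proof of Thm. 10.9); [Lang1990] Ch. 13 §2 Thm. 2.1 (proof).
-/

set_option autoImplicit false
-- `…BirchSwinnertonDyer.BirchSwinnertonDyer.Theorems…` is the problem's mandated namespace (D-0017).
set_option linter.dupNamespace false

noncomputable section

namespace Summit.BirchSwinnertonDyer.BirchSwinnertonDyer.Theorems.PrintCFram.KummerRadical

open Literature.NumberTheory.NumberFields Literature.NumberTheory.GaloisRepresentations Literature.FieldTheory.Kummer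
open NumberField IsDedekindDomain Field
open scoped nonZeroDivisors Pointwise

set_option maxSynthPendingDepth 3

section Tools

variable {K : Type} [Field K] [NumberField K] {p : ℕ} [hp : Fact p.Prime]

omit [NumberField K] in
/-- **Inertia via a representative**: if `α γ^p = a ∈ 𝓞_K ∖ v` (`v ∤ p`), then the Kummer character of a `p`-th root `β` of `α`
kills the inertia above `v` (apply `kummer_character_eq_one_of_mem_inertia` to the root `β γ` of `a`). [folklore] -/
theorem kummer_character_eq_one_of_mem_inertia_of_repr {ζ : K} (hζ : IsPrimitiveRoot ζ p) {α : K}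
    {β : AlgebraicClosure K} (hβ : β ^ p = algebraMap K (AlgebraicClosure K) α)
    (κ : absoluteGaloisGroup K →* Multiplicative (ZMod p))
    (hκ : ∀ σ : absoluteGaloisGroup K,
      σ • β = algebraMap K (AlgebraicClosure K) ζ ^ ((κ σ).toAdd : ZMod p).val * β)
    {v : HeightOneSpectrum (𝓞 K)} (hv : ((p : ℕ) : 𝓞 K) ∉ v.asIdeal)
    {γ : K} {a : 𝓞 K} (ha : a ∉ v.asIdeal) (hrepr : α * γ ^ p = (a : K))
    {𝔔 : Ideal (absIntegers (𝓞 K) K)} (h𝔔 : 𝔔 ∈ v.primesAbove)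
    {g : absoluteGaloisGroup K} (hg : g ∈ 𝔔.inertia (absoluteGaloisGroup K)) : κ g = 1 := by
  have hβ' : (β * algebraMap K (AlgebraicClosure K) γ) ^ p = algebraMap K (AlgebraicClosure K) (a : K) := by
    rw [mul_pow, hβ, ← map_pow, ← map_mul, hrepr]
  refine kummer_character_eq_one_of_mem_inertia hζ hβ' κ (fun σ => ?_) hv ha h𝔔 hg
  rw [smul_mul', hκ σ, absoluteGaloisGroup.smul_def σ (algebraMap K _ γ), AlgEquiv.commutes, mul_assoc]

omit [NumberField K] in
/-- A `p`-th power in `K` of an element whose `p`-th power is a unit is the `p`-th power of a unit. [folklore] -/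
theorem exists_unit_pow_eq {y : K} {u : (𝓞 K)ˣ} (h : y ^ p = ((u : 𝓞 K) : K)) : ∃ w : (𝓞 K)ˣ, u = w ^ p := by
  have hint : IsIntegral ℤ y := by
    refine IsIntegral.of_pow hp.out.pos ?_
    rw [h]; exact (u : 𝓞 K).isIntegral_coe
  set y' : 𝓞 K := ⟨y, hint⟩ with hy'
  have hpow : y' ^ p = (u : 𝓞 K) := by
    apply RingOfIntegers.coe_injective
    change ((y' ^ p : 𝓞 K) : K) = ((u : 𝓞 K) : K)
    push_cast
    exact h
  have hunit : IsUnit y' := by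
    rw [← isUnit_pow_iff hp.out.ne_zero, hpow]; exact Units.isUnit u
  exact ⟨hunit.unit, Units.ext (by rw [Units.val_pow_eq_pow_val]; exact hpow.symm)⟩

omit [NumberField K] in
/-- Bezout mod `p`: `p ∤ j ⟹ ∃ m, j m ≡ 1 (mod p)`. [folklore] -/
theorem exists_mul_mod_eq_one' {j : ℕ} (hj : ¬ p ∣ j) : ∃ m : ℕ, j * m % p = 1 := by
  have hu : (j : ZMod p) ≠ 0 := by rwa [Ne, ZMod.natCast_eq_zero_iff]
  refine ⟨((j : ZMod p)⁻¹).val, ?_⟩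
  have h : ((j * ((j : ZMod p)⁻¹).val : ℕ) : ZMod p) = ((1 : ℕ) : ZMod p) := by
    rw [Nat.cast_mul, ZMod.natCast_zmod_val, mul_inv_cancel₀ hu, Nat.cast_one]
  rw [(ZMod.natCast_eq_natCast_iff' _ _ _).1 h, Nat.mod_eq_of_lt hp.out.one_lt]

end Tools

/-! ## The two characters -/

section Two

variable {K : Type} [Field K] [NumberField K] [IsCMField K] [IsGalois ℚ K] {p : ℕ} [hp : Fact p.Prime]

/-- **EVEN-IRREGULAR ⟹ TWO INDEPENDENT ADMISSIBLE CHARACTERS.** `K` CM, Galois over `ℚ`, `p ∤ [K:ℚ]`, `ζ ∈ K` a primitive `p`-th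
root of unity with `σζ = ζ^{a σ}`; `θ : Gal(K/ℚ) →* ℤ_pˣ` EVEN (`θ(c) = 1`), `≠ 1`, `θ ≡ e (mod p)`; `x ∈ Cl(𝓞 K)` an `e`-eigenclass
of order `p`, `x ≠ 1` («`e_θ(Cl_K)[p] ≠ 0`», EVEN-IRREGULARITY). Then there are characters `κ₁ κ₂ : Γ_K →* ℤ/p` with open kernels,
killing the inertia group of every prime of `\bar ℤ_K` above every `v ∤ p`, satisfying the conjugation law
`κ(θ_γ σ) = κ(σ)^{a γ̄ · e γ̄⁻¹}`, and INDEPENDENT: `κ₁^i κ₂^j = 1 ⟹ p ∣ i ∧ p ∣ j`. (`κ₁` = Kummer character of Herbrand's Minkowski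
`θ̄`-unit, `κ₂` = of the class radical of `x`.) [cite: Washington1997, §10.2 (proof of Thm. 10.9)] [cite: Lang1990, Ch. 13 §2 Thm. 2.1 (proof)] -/
theorem exists_two_independent_kummer_characters (hpK : ¬ p ∣ Module.finrank ℚ K) {ζ : K} (hζ : IsPrimitiveRoot ζ p)
    (a : (K ≃ₐ[ℚ] K) → ℕ) (ha : ∀ σ₀ : K ≃ₐ[ℚ] K, σ₀ ζ = ζ ^ a σ₀)
    (θ : (K ≃ₐ[ℚ] K) →* ℤ_[p]ˣ) (hθ1 : θ ≠ 1) (hθc : θ ((IsCMField.complexConj K).restrictScalars ℚ) = 1)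
    (e : (K ≃ₐ[ℚ] K) → ℕ) (hθe : ∀ σ, ‖((θ σ : ℤ_[p]ˣ) : ℤ_[p]) - (e σ : ℤ_[p])‖ < 1)
    (x : ClassGroup (𝓞 K)) (hx1 : x ≠ 1) (hxp : x ^ p = 1)
    (hxe : ∀ σ : K ≃ₐ[ℚ] K, classGroupRep ℚ K σ (Additive.ofMul x) = e σ • Additive.ofMul x) :
    ∃ κ₁ κ₂ : absoluteGaloisGroup K →* Multiplicative (ZMod p),
      (IsOpen (κ₁.ker : Set (absoluteGaloisGroup K)) ∧
        (∀ v : HeightOneSpectrum (𝓞 K), ((p : ℕ) : 𝓞 K) ∉ v.asIdeal →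
          ∀ 𝔔 ∈ v.primesAbove, ∀ g ∈ 𝔔.inertia (absoluteGaloisGroup K), κ₁ g = 1) ∧
        ∀ (γ : absoluteGaloisGroup ℚ) (σ : absoluteGaloisGroup K),
          κ₁ (absGaloisOuterConj ℚ K γ σ) = κ₁ σ ^ (a (absGaloisQuot ℚ K γ) * e (absGaloisQuot ℚ K γ)⁻¹)) ∧
      (IsOpen (κ₂.ker : Set (absoluteGaloisGroup K)) ∧
        (∀ v : HeightOneSpectrum (𝓞 K), ((p : ℕ) : 𝓞 K) ∉ v.asIdeal →
          ∀ 𝔔 ∈ v.primesAbove, ∀ g ∈ 𝔔.inertia (absoluteGaloisGroup K), κ₂ g = 1) ∧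
        ∀ (γ : absoluteGaloisGroup ℚ) (σ : absoluteGaloisGroup K),
          κ₂ (absGaloisOuterConj ℚ K γ σ) = κ₂ σ ^ (a (absGaloisQuot ℚ K γ) * e (absGaloisQuot ℚ K γ)⁻¹)) ∧
      ∀ i j : ℕ, κ₁ ^ i * κ₂ ^ j = 1 → p ∣ i ∧ p ∣ j := by
  haveI : NeZero p := ⟨hp.out.ne_zero⟩
  set ζ' := algebraMap K (AlgebraicClosure K) ζ with hζ'
  have hζ'p : IsPrimitiveRoot ζ' p := hζ.map_of_injective (algebraMap K (AlgebraicClosure K)).injective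
  -- the two radicals
  obtain ⟨u, hu_eig, hu_not⟩ := UnitGalois.exists_even_eigenunit hpK θ hθ1 hθc e hθe
  obtain ⟨α, hα0, hα_eig, hα_repr, hα_not⟩ := exists_eigenRadical_of_eigenclass hpK θ e hθe x hx1 hxp hxe
  have hu0 : ((u : 𝓞 K) : K) ≠ 0 := by simp
  have hαK0 : (α : K) ≠ 0 := RingOfIntegers.coe_ne_zero_iff.mpr hα0
  have hu_eigK : ∀ σ₀ : K ≃ₐ[ℚ] K, ∃ y : K, σ₀ ((u : 𝓞 K) : K) = ((u : 𝓞 K) : K) ^ e σ₀ * y ^ p := by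
    intro σ₀
    obtain ⟨v, hv⟩ := hu_eig σ₀
    refine ⟨((v : 𝓞 K) : K), ?_⟩
    have h := congrArg (fun z : (𝓞 K)ˣ => ((z : 𝓞 K) : K)) hv
    simp only [UnitGalois.coe_unitsGal] at h
    rw [h]; push_cast; ring
  -- roots and characters
  obtain ⟨β₁, hβ₁⟩ := IsAlgClosed.exists_pow_nat_eq (algebraMap K (AlgebraicClosure K) ((u : 𝓞 K) : K)) hp.out.pos
  obtain ⟨β₂, hβ₂⟩ := IsAlgClosed.exists_pow_nat_eq (algebraMap K (AlgebraicClosure K) (α : K)) hp.out.pos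
  obtain ⟨κ₁, hκ₁⟩ := exists_kummer_character hζ hu0 hβ₁
  obtain ⟨κ₂, hκ₂⟩ := exists_kummer_character hζ hαK0 hβ₂
  have hβ₁0 : β₁ ≠ 0 := fun h => by
    rw [h, zero_pow hp.out.ne_zero, eq_comm, map_eq_zero] at hβ₁; exact hu0 hβ₁
  have hβ₂0 : β₂ ≠ 0 := fun h => by
    rw [h, zero_pow hp.out.ne_zero, eq_comm, map_eq_zero] at hβ₂; exact hαK0 hβ₂
  refine ⟨κ₁, κ₂, ⟨isOpen_ker_kummer_character hζ hu0 hβ₁ κ₁ hκ₁, fun v hv 𝔔 h𝔔 g hg => ?_, fun γ σ => ?_⟩,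
    ⟨isOpen_ker_kummer_character hζ hαK0 hβ₂ κ₂ hκ₂, fun v hv 𝔔 h𝔔 g hg => ?_, fun γ σ => ?_⟩, fun i j hij => ?_⟩
  · exact kummer_character_eq_one_of_mem_inertia (α := (u : 𝓞 K)) hζ hβ₁ κ₁ hκ₁ hv
      (fun hmem => v.isPrime.ne_top (v.asIdeal.eq_top_of_isUnit_mem hmem (Units.isUnit u))) h𝔔 hg
  · exact kummer_character_absGaloisOuterConj hζ a ha hu0 e hu_eigK hβ₁ κ₁ hκ₁ γ σ
  · obtain ⟨γ', a', ha', hrepr⟩ := hα_repr v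
    exact kummer_character_eq_one_of_mem_inertia_of_repr hζ hβ₂ κ₂ hκ₂ hv ha' hrepr h𝔔 hg
  · exact kummer_character_absGaloisOuterConj hζ a ha hαK0 e hα_eig hβ₂ κ₂ hκ₂ γ σ
  · -- independence
    -- `B = β₁^i β₂^j` is fixed by `Γ_K`
    set B : AlgebraicClosure K := β₁ ^ i * β₂ ^ j with hB
    have hfix : ∀ σ : absoluteGaloisGroup K, σ • B = B := by
      intro σ
      have hrel : κ₁ σ ^ i * κ₂ σ ^ j = 1 := by
        have := DFunLike.congr_fun hij σ
        rwa [MonoidHom.mul_apply, MonoidHom.pow_apply, MonoidHom.pow_apply, MonoidHom.one_apply] at this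
      have hexp : (i * ((κ₁ σ).toAdd : ZMod p).val + j * ((κ₂ σ).toAdd : ZMod p).val : ZMod p) = 0 := by
        have h1 := congrArg Multiplicative.toAdd hrel
        rw [toAdd_mul, toAdd_pow, toAdd_pow, toAdd_one] at h1
        rw [ZMod.natCast_zmod_val, ZMod.natCast_zmod_val, ← smul_eq_mul, ← smul_eq_mul, Nat.cast_smul_eq_nsmul,
          Nat.cast_smul_eq_nsmul]
        exact h1
      have hζpow : ζ' ^ (i * ((κ₁ σ).toAdd : ZMod p).val + j * ((κ₂ σ).toAdd : ZMod p).val) = 1 := by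
        have hdvd : p ∣ i * ((κ₁ σ).toAdd : ZMod p).val + j * ((κ₂ σ).toAdd : ZMod p).val := by
          rw [← ZMod.natCast_eq_zero_iff]; push_cast; exact hexp
        obtain ⟨m, hm⟩ := hdvd
        rw [hm, pow_mul, hζ'p.pow_eq_one, one_pow]
      rw [hB, smul_mul', smul_pow', smul_pow', hκ₁ σ, hκ₂ σ, mul_pow, mul_pow, ← pow_mul, ← pow_mul]
      calc ζ' ^ (((κ₁ σ).toAdd : ZMod p).val * i) * β₁ ^ i * (ζ' ^ (((κ₂ σ).toAdd : ZMod p).val * j) * β₂ ^ j)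
          = ζ' ^ (i * ((κ₁ σ).toAdd : ZMod p).val + j * ((κ₂ σ).toAdd : ZMod p).val) * (β₁ ^ i * β₂ ^ j) := by ring
        _ = β₁ ^ i * β₂ ^ j := by rw [hζpow, one_mul]
    obtain ⟨y, hy⟩ := (InfiniteGalois.mem_range_algebraMap_iff_fixed (k := K) B).2 (fun σ => by
      have := hfix ((absoluteGaloisGroup.toAlgEquiv K).symm σ)
      rwa [absoluteGaloisGroup.toAlgEquiv_symm_apply] at this)
    -- `u^i α^j = y^p` in `K`
    have hrad : ((u : 𝓞 K) : K) ^ i * (α : K) ^ j = y ^ p := by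
      apply (algebraMap K (AlgebraicClosure K)).injective
      rw [map_pow, hy, hB, mul_pow, ← pow_mul, ← pow_mul, mul_comm i p, mul_comm j p, pow_mul, pow_mul, hβ₁, hβ₂,
        map_mul, map_pow, map_pow]
    set U : K := ((u : 𝓞 K) : K) with hU
    set A : K := (α : K) with hA
    -- case `p ∤ j`: then `α ∈ E_K K^{×p}`
    have hj : p ∣ j := by
      by_contra hj
      obtain ⟨m, hm⟩ := exists_mul_mod_eq_one' hj
      have hjm : j * m = p * (j * m / p) + 1 := by
        have := Nat.div_add_mod (j * m) p
        rw [hm] at this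
        omega
      set q : ℕ := j * m / p with hq
      have key : y ^ (p * m) = U ^ (i * m) * A ^ (p * q + 1) := by
        rw [pow_mul, ← hrad, mul_pow, ← pow_mul, ← pow_mul, hjm]
      apply hα_not (u ^ (i * m))⁻¹ (y ^ m / A ^ q)
      have hcoe : ((((u ^ (i * m))⁻¹ : (𝓞 K)ˣ) : 𝓞 K) : K) = (U ^ (i * m))⁻¹ := by
        apply eq_inv_of_mul_eq_one_left
        have h := congrArg (fun z : 𝓞 K => (z : K)) (Units.inv_mul (u ^ (i * m)))
        push_cast at h
        rw [hU]
        exact h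
      rw [hcoe, div_pow, ← pow_mul, mul_comm m p, key]
      field_simp
      ring
    obtain ⟨j', rfl⟩ := hj
    refine ⟨?_, dvd_mul_right p j'⟩
    -- case `p ∣ j`, `p ∤ i`: then `u ∈ E_K^p`
    by_contra hi
    obtain ⟨m, hm⟩ := exists_mul_mod_eq_one' hi
    have him : i * m = p * (i * m / p) + 1 := by
      have := Nat.div_add_mod (i * m) p
      rw [hm] at this
      omega
    set q : ℕ := i * m / p with hq
    have key : y ^ (p * m) = U ^ (p * q + 1) * A ^ (p * j' * m) := by
      rw [pow_mul, ← hrad, mul_pow, ← pow_mul, ← pow_mul, him]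
    -- `z = y^m / (U^q A^{j' m})` has `z^p = U`
    set z : K := y ^ m / (U ^ q * A ^ (j' * m)) with hz
    have hzp : z ^ p = ((u : 𝓞 K) : K) := by
      rw [hz, div_pow, ← pow_mul, mul_comm m p, key, ← hU]
      field_simp
      ring
    obtain ⟨w, hw⟩ := exists_unit_pow_eq hzp
    exact hu_not 1 (Subgroup.one_mem _) w (by rw [one_mul]; exact hw)

end Two

end Summit.BirchSwinnertonDyer.BirchSwinnertonDyer.Theorems.PrintCFram.KummerRadical

end
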